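import Literature.NumberTheory.Sieve.SmoothParitySingularLocal
import Literature.NumberTheory.Sieve.SmoothEndgameEuler
import HarnessLib

/-!
# The parity-class singular series: the multiplicative majorant and the Euler-product bound

Topic `Literature/NumberTheory/Sieve`; a PROVED tool file continuing `SmoothParitySingularLocal`
([MontgomeryVaughanActa1975, §5–6], [Harper2016, §2.2, §5], [MontgomeryVaughan2007, §1.3]). Notation:
`Λ = unitLocalFactor α`, `T(k) = parityUnitTermR α d₁ d₂ k = φ(k) Λ(k; d₁) Λ(k; d₂) G_α(k)` (the unit term as a real
number, `parityUnitTerm_eq_ofReal`), `B_p = 2(1 − α) log p`, `c_p = majorConst α p = B_p (1 + B_p)²`.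

* `unitLocalFactor_prime_pow_le`: `Λ(p^j; h) ≤ (h, p^j)^α p^{−jα} (1 + B_p)`; `unitLocalFactor_mul_of_coprime`
  (`Λ` is multiplicative in `k`) and `unitLocalFactor_mem_Icc`: `0 ≤ Λ(k; h) ≤ 1` for all `k ≥ 1`;
* `parityUnitTermR_nonneg`, `norm_parityUnitTerm` (`‖parityUnitTerm k‖ = T(k) ≥ 0`), `parityUnitTermR_one`,
  multiplicativity;
* the multiplicative majorant `unitMajorant = M(k) = ((d₁,k)(d₂,k))^α k^{−(3α−1)} ∏_{p ∣ k} c_p` with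
  `T(p^n) ≤ M(p^n)` (`parityUnitTermR_prime_pow_le`) and hence `T(k) ≤ M(k)` for all `k ≥ 1`
  (`parityUnitTermR_le_unitMajorant`, induction on the factorisation);
* the Euler-product bound `sum_rpow_mul_parityUnitTermR_le`: for `13/15 < α ≤ 1`, `δ < 3α − 13/5`,
  `Σ_{k ≤ N} k^δ T(k) ≤ (d₁d₂)^α exp(2420 (1 − α)/(3α − 13/5 − δ))` (`c_p ≤ 1210(1−α)p^{3/5}`,
  `sum_rpow_neg_mul_prod_primeFactors_le`), and `summable_rpow_mul_norm_parityUnitTerm`;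
* the comparisons `‖paritySingTerm (2k+1)‖ ≤ ‖T(2k+1)‖`, `‖paritySingTerm (2k)‖ ≤ ‖T(k)‖` (`d₁` even, `σd₂` odd)
  feeding the absolute convergence of the singular series in `SmoothParitySingularBounds`.

## References

* H. L. Montgomery, R. C. Vaughan, *The exceptional set in Goldbach's problem*, Acta Arith. 27 (1975), §5–6
  (singular series of a ternary problem with congruence conditions; local factors) [MontgomeryVaughanActa1975].
* A. J. Harper, Compositio Math. 152 (2016), §2.2, §5 (the smooth local factors `G_α`, `H_α`) [Harper2016].
* H. L. Montgomery, R. C. Vaughan, *Multiplicative Number Theory I* (2007), Thm 4.1 (Ramanujan sums), §1.3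
  (Euler products) [MontgomeryVaughan2007].
-/

noncomputable section

open Finset Real Complex
open scoped ArithmeticFunction.Moebius FourierTransform

namespace Literature.NumberTheory.Sieve

namespace SmoothArcs

/-- **The sharper bound** `Λ_α(p^j; h) ≤ (h, p^j)^α (p^j)^{−α} (1 + 2(1−α) log p)` (`= 1 ≤ 1 + …` if `p^j ∣ h`;
`= G_α(p^{j−v}) ≤ p^{−(j−v)α} 2(1−α) log p` if `p^v ∥ h`, `v < j`). [folklore] -/
theorem unitLocalFactor_prime_pow_le {α : ℝ} (hα0 : 0 ≤ α) (hα1 : α ≤ 1) {p : ℕ} (hp : p.Prime) (j : ℕ) (h : ℤ) :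
    unitLocalFactor α (p ^ j) h ≤ ((Nat.gcd h.natAbs (p ^ j) : ℕ) : ℝ) ^ α * ((p ^ j : ℕ) : ℝ) ^ (-α) *
      (1 + 2 * (1 - α) * Real.log p) := by
  have hp0 : (0 : ℝ) < p := by exact_mod_cast hp.pos
  have hlog : 0 ≤ Real.log p := Real.log_nonneg (by exact_mod_cast hp.one_lt.le)
  have hB : 0 ≤ 2 * (1 - α) * Real.log p := mul_nonneg (by linarith) hlog
  by_cases hdvd : p ^ j ∣ h.natAbs
  · have hpj : (0 : ℝ) < ((p ^ j : ℕ) : ℝ) := by exact_mod_cast pow_pos hp.pos j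
    rw [unitLocalFactor_prime_pow_of_dvd α hp hdvd, Nat.gcd_eq_right hdvd, ← Real.rpow_add hpj,
      add_neg_cancel, Real.rpow_zero, one_mul]
    linarith
  · obtain ⟨v, i, rfl, hv, hv'⟩ := exists_eq_add_of_not_pow_dvd hp hdvd
    rw [unitLocalFactor_prime_pow_of_not_dvd α hp hv hv' i]
    have hG := (localG_bounds hα1 (pow_ne_zero (i + 1) hp.ne_zero)).2
    rw [Nat.primeFactors_prime_pow (Nat.succ_ne_zero i) hp, Finset.prod_singleton] at hG
    have hgcd : ((p ^ v : ℕ) : ℝ) ≤ (Nat.gcd h.natAbs (p ^ (v + 1 + i)) : ℕ) := by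
      exact_mod_cast Nat.le_of_dvd (Nat.gcd_pos_of_pos_right _ (pow_pos hp.pos _))
        (Nat.dvd_gcd hv (pow_dvd_pow p (by omega)))
    have hpv : ((p ^ v : ℕ) : ℝ) ^ α * ((p ^ (v + 1 + i) : ℕ) : ℝ) ^ (-α) = ((p ^ (i + 1) : ℕ) : ℝ) ^ (-α) := by
      push_cast
      rw [show ((p : ℝ) ^ (v + 1 + i)) = (p : ℝ) ^ v * (p : ℝ) ^ (i + 1) by ring,
        Real.mul_rpow (pow_nonneg hp0.le _) (pow_nonneg hp0.le _), ← mul_assoc, ← Real.rpow_add (pow_pos hp0 _),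
        add_neg_cancel, Real.rpow_zero, one_mul]
    have hnn : 0 ≤ ((p ^ (i + 1) : ℕ) : ℝ) ^ (-α) := Real.rpow_nonneg (by positivity) _
    calc localG α (p ^ (i + 1)) ≤ ((p ^ (i + 1) : ℕ) : ℝ) ^ (-α) * (2 * (1 - α) * Real.log p) := hG
      _ ≤ ((p ^ (i + 1) : ℕ) : ℝ) ^ (-α) * (1 + 2 * (1 - α) * Real.log p) :=
          mul_le_mul_of_nonneg_left (by linarith) hnn
      _ = ((p ^ v : ℕ) : ℝ) ^ α * ((p ^ (v + 1 + i) : ℕ) : ℝ) ^ (-α) * (1 + 2 * (1 - α) * Real.log p) := by rw [hpv]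
      _ ≤ _ := by
          refine mul_le_mul_of_nonneg_right (mul_le_mul_of_nonneg_right ?_ (Real.rpow_nonneg (by positivity) _))
            (by linarith)
          exact Real.rpow_le_rpow (by positivity) hgcd hα0

/-- `Λ_α(·; h)` is multiplicative: `Λ(k₁k₂; h) = Λ(k₁; h) Λ(k₂; h)` for coprime `k₁, k₂` (CRT; the unit twists are
invisible at modulus `1`). [folklore] -/
theorem unitLocalFactor_mul_of_coprime (α : ℝ) {k₁ k₂ : ℕ} (hk : k₁.Coprime k₂) (h : ℤ) :
    unitLocalFactor α (k₁ * k₂) h = unitLocalFactor α k₁ h * unitLocalFactor α k₂ h := by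
  rcases eq_or_ne k₁ 0 with rfl | hk₁
  · simp [unitLocalFactor]
  rcases eq_or_ne k₂ 0 with rfl | hk₂
  · simp [unitLocalFactor]
  obtain ⟨u₁, hu₁⟩ := exists_nat_mul_modEq_one hk hk₁
  obtain ⟨u₂, hu₂⟩ := exists_nat_mul_modEq_one hk.symm hk₂
  have hu₁' : (u₁ : ℤ) * k₂ ≡ 1 [ZMOD k₁] := by
    have := Int.natCast_modEq_iff.mpr hu₁; push_cast at this; exact this
  have hu₂' : (u₂ : ℤ) * k₁ ≡ 1 [ZMOD k₂] := by
    have := Int.natCast_modEq_iff.mpr hu₂; push_cast at this; exact this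
  have hc1 : (k₁ * 1).Coprime (k₂ * 1) := by simpa using hk
  have key := classLocalFactor_mul_of_coprime α hk₁ hk₂ one_ne_zero one_ne_zero hc1 0 hu₁' hu₂' (h := h)
  rw [mul_one, classLocalFactor_one_mul_unit α 0 (by simpa using (Nat.coprime_of_mul_modEq_one k₂ hu₁).symm) h,
    classLocalFactor_one_mul_unit α 0 (by simpa using (Nat.coprime_of_mul_modEq_one k₁ hu₂).symm) h,
    classLocalFactor_one_eq_ofReal, classLocalFactor_one_eq_ofReal, classLocalFactor_one_eq_ofReal] at key
  exact_mod_cast key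

/-- **`0 ≤ Λ_α(k; h) ≤ 1`** for all `k ≥ 1`, `0 ≤ α ≤ 1` (multiplicativity and the prime-power case). [folklore] -/
theorem unitLocalFactor_mem_Icc {α : ℝ} (hα0 : 0 ≤ α) (hα1 : α ≤ 1) {k : ℕ} (hk : k ≠ 0) (h : ℤ) :
    unitLocalFactor α k h ∈ Set.Icc (0 : ℝ) 1 := by
  induction k using Nat.recOnPosPrimePosCoprime with
  | zero => exact absurd rfl hk
  | one => rw [unitLocalFactor_one]; exact ⟨zero_le_one, le_rfl⟩
  | prime_pow p n hp _ => exact unitLocalFactor_prime_pow_mem_Icc hα0 hα1 hp n h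
  | coprime a b ha hb hab iha ihb =>
    rw [unitLocalFactor_mul_of_coprime α hab]
    obtain ⟨ha0, ha1⟩ := iha (by omega)
    obtain ⟨hb0, hb1⟩ := ihb (by omega)
    exact ⟨mul_nonneg ha0 hb0, mul_le_one₀ ha1 hb0 hb1⟩

/-! ### The unit term as a non-negative real number; the pointwise majorant -/

/-- The unit term as a real number: `T(k) = φ(k) Λ(k; d₁) Λ(k; d₂) G_α(k)`. [folklore] -/
def parityUnitTermR (α : ℝ) (d₁ d₂ k : ℕ) : ℝ :=
  (k.totient : ℝ) * (unitLocalFactor α k d₁ * unitLocalFactor α k d₂ * localG α k)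

/-- `parityUnitTerm = parityUnitTermR` (as a complex number) for `σ = ±1`. [folklore] -/
theorem parityUnitTerm_eq_ofReal (α : ℝ) {σ : ℤ} (hσ : σ = 1 ∨ σ = -1) (d₁ d₂ k : ℕ) :
    parityUnitTerm α σ d₁ d₂ k = (parityUnitTermR α d₁ d₂ k : ℂ) := by
  rcases eq_or_ne k 0 with rfl | hk
  · simp [parityUnitTerm, parityUnitTermR]
  rw [parityUnitTerm_eq α hσ d₁ d₂ hk, classLocalFactor_one_eq_ofReal, classLocalFactor_one_eq_ofReal, parityUnitTermR]
  push_cast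
  ring

/-- `T(k) ≥ 0` for `0 ≤ α ≤ 1`. [folklore] -/
theorem parityUnitTermR_nonneg {α : ℝ} (hα0 : 0 ≤ α) (hα1 : α ≤ 1) (d₁ d₂ k : ℕ) : 0 ≤ parityUnitTermR α d₁ d₂ k := by
  rcases eq_or_ne k 0 with rfl | hk
  · simp [parityUnitTermR]
  exact mul_nonneg (Nat.cast_nonneg _) (mul_nonneg (mul_nonneg (unitLocalFactor_mem_Icc hα0 hα1 hk _).1
    (unitLocalFactor_mem_Icc hα0 hα1 hk _).1) (localG_bounds hα1 hk).1)

/-- `‖parityUnitTerm k‖ = T(k)`. [folklore] -/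
theorem norm_parityUnitTerm {α : ℝ} (hα0 : 0 ≤ α) (hα1 : α ≤ 1) {σ : ℤ} (hσ : σ = 1 ∨ σ = -1) (d₁ d₂ k : ℕ) :
    ‖parityUnitTerm α σ d₁ d₂ k‖ = parityUnitTermR α d₁ d₂ k := by
  rw [parityUnitTerm_eq_ofReal α hσ, Complex.norm_real, Real.norm_of_nonneg (parityUnitTermR_nonneg hα0 hα1 _ _ _)]

/-- `T(1) = 1`. [folklore] -/
theorem parityUnitTermR_one (α : ℝ) (d₁ d₂ : ℕ) : parityUnitTermR α d₁ d₂ 1 = 1 := by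
  simp [parityUnitTermR, unitLocalFactor_one, localG_one]

/-- `T` is multiplicative on coprime arguments. [folklore] -/
theorem parityUnitTermR_mul_of_coprime (α : ℝ) (d₁ d₂ : ℕ) {a b : ℕ} (hab : a.Coprime b) :
    parityUnitTermR α d₁ d₂ (a * b) = parityUnitTermR α d₁ d₂ a * parityUnitTermR α d₁ d₂ b := by
  have h := parityUnitTerm_mul_of_coprime α 1 d₁ d₂ hab
  rw [parityUnitTerm_eq_ofReal α (Or.inl rfl), parityUnitTerm_eq_ofReal α (Or.inl rfl),
    parityUnitTerm_eq_ofReal α (Or.inl rfl)] at h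
  exact_mod_cast h

/-- The prime constants of the majorant: `c_p = B_p (1 + B_p)²`, `B_p = 2(1 − α) log p`. [folklore] -/
def majorConst (α : ℝ) (p : ℕ) : ℝ := 2 * (1 - α) * Real.log p * (1 + 2 * (1 - α) * Real.log p) ^ 2

/-- `c_p ≥ 0` (for every `p : ℕ`, `α ≤ 1`). [folklore] -/
theorem majorConst_nonneg {α : ℝ} (hα1 : α ≤ 1) (p : ℕ) : 0 ≤ majorConst α p := by
  unfold majorConst
  have hlog : 0 ≤ Real.log p := by
    rcases Nat.eq_zero_or_pos p with rfl | hp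
    · simp
    · exact Real.log_nonneg (by exact_mod_cast hp)
  have : 0 ≤ 1 - α := by linarith
  positivity

/-- The multiplicative majorant `M(k) = ((d₁, k)(d₂, k))^α k^{−(3α−1)} ∏_{p ∣ k} c_p`. [folklore] -/
def unitMajorant (α : ℝ) (d₁ d₂ k : ℕ) : ℝ :=
  ((Nat.gcd d₁ k * Nat.gcd d₂ k : ℕ) : ℝ) ^ α * ((k : ℝ) ^ (-(3 * α - 1)) * ∏ p ∈ k.primeFactors, majorConst α p)

/-- `M(k) ≥ 0`. [folklore] -/
theorem unitMajorant_nonneg {α : ℝ} (hα1 : α ≤ 1) (d₁ d₂ k : ℕ) : 0 ≤ unitMajorant α d₁ d₂ k :=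
  mul_nonneg (Real.rpow_nonneg (Nat.cast_nonneg _) _) (mul_nonneg (Real.rpow_nonneg (Nat.cast_nonneg _) _)
    (Finset.prod_nonneg fun p _ => majorConst_nonneg hα1 p))

/-- `M` is multiplicative on coprime arguments. [folklore] -/
theorem unitMajorant_mul_of_coprime (α : ℝ) (d₁ d₂ : ℕ) {a b : ℕ} (hab : a.Coprime b) :
    unitMajorant α d₁ d₂ (a * b) = unitMajorant α d₁ d₂ a * unitMajorant α d₁ d₂ b := by
  unfold unitMajorant
  rw [Nat.Coprime.gcd_mul d₁ hab, Nat.Coprime.gcd_mul d₂ hab, Nat.Coprime.primeFactors_mul hab,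
    Finset.prod_union hab.disjoint_primeFactors]
  push_cast
  rw [Real.mul_rpow (Nat.cast_nonneg a) (Nat.cast_nonneg b),
    show ((Nat.gcd d₁ a : ℝ) * (Nat.gcd d₁ b) * ((Nat.gcd d₂ a) * (Nat.gcd d₂ b))) =
      ((Nat.gcd d₁ a : ℝ) * (Nat.gcd d₂ a)) * ((Nat.gcd d₁ b) * (Nat.gcd d₂ b)) by ring,
    Real.mul_rpow (by positivity) (by positivity)]
  ring

/-- **The prime-power bound** `T(p^n) ≤ M(p^n)` (`n ≥ 1`, `0 ≤ α ≤ 1`): `φ(p^n) ≤ p^n`, the two `Λ`'s by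
`unitLocalFactor_prime_pow_le`, `G_α(p^n) ≤ p^{−nα} B_p`. [folklore] -/
theorem parityUnitTermR_prime_pow_le {α : ℝ} (hα0 : 0 ≤ α) (hα1 : α ≤ 1) (d₁ d₂ : ℕ) {p n : ℕ} (hp : p.Prime)
    (hn : 0 < n) : parityUnitTermR α d₁ d₂ (p ^ n) ≤ unitMajorant α d₁ d₂ (p ^ n) := by
  have hP : (0 : ℝ) < ((p ^ n : ℕ) : ℝ) := by exact_mod_cast pow_pos hp.pos n
  set P : ℝ := ((p ^ n : ℕ) : ℝ) with hPdef
  set B : ℝ := 2 * (1 - α) * Real.log p with hB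
  have hlog : 0 ≤ Real.log p := Real.log_nonneg (by exact_mod_cast hp.one_lt.le)
  have hB0 : 0 ≤ B := mul_nonneg (by linarith) hlog
  have hφ : ((p ^ n).totient : ℝ) ≤ P := by rw [hPdef]; exact_mod_cast Nat.totient_le _
  have hΛ : ∀ d : ℕ, unitLocalFactor α (p ^ n) d ≤ ((Nat.gcd d (p ^ n) : ℕ) : ℝ) ^ α * P ^ (-α) * (1 + B) := by
    intro d
    have h1 := unitLocalFactor_prime_pow_le hα0 hα1 hp n (d : ℤ)
    rw [Int.natAbs_natCast] at h1
    exact h1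
  have hΛ0 : ∀ d : ℕ, 0 ≤ unitLocalFactor α (p ^ n) d := fun d =>
    (unitLocalFactor_prime_pow_mem_Icc hα0 hα1 hp n (d : ℤ)).1
  have hG : localG α (p ^ n) ≤ P ^ (-α) * B := by
    have := (localG_bounds hα1 (pow_ne_zero n hp.ne_zero)).2
    rwa [Nat.primeFactors_prime_pow hn.ne' hp, Finset.prod_singleton] at this
  have hG0 : 0 ≤ localG α (p ^ n) := (localG_bounds hα1 (pow_ne_zero n hp.ne_zero)).1
  have hpow : P * (P ^ (-α) * P ^ (-α) * P ^ (-α)) = P ^ (-(3 * α - 1)) := by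
    have e : -(3 * α - 1) = 1 + (-α) + (-α) + (-α) := by ring
    rw [e, Real.rpow_add hP, Real.rpow_add hP, Real.rpow_add hP, Real.rpow_one]
    ring
  calc parityUnitTermR α d₁ d₂ (p ^ n)
      ≤ P * ((((Nat.gcd d₁ (p ^ n) : ℕ) : ℝ) ^ α * P ^ (-α) * (1 + B)) *
          ((((Nat.gcd d₂ (p ^ n) : ℕ) : ℝ) ^ α * P ^ (-α) * (1 + B))) * (P ^ (-α) * B)) := by
        unfold parityUnitTermR
        refine mul_le_mul hφ (mul_le_mul (mul_le_mul (hΛ d₁) (hΛ d₂) (hΛ0 d₂) (by positivity)) hG hG0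
          (by positivity)) (mul_nonneg (mul_nonneg (hΛ0 d₁) (hΛ0 d₂)) hG0) hP.le
    _ = unitMajorant α d₁ d₂ (p ^ n) := by
        rw [unitMajorant, Nat.primeFactors_prime_pow hn.ne' hp, Finset.prod_singleton, majorConst, ← hB, ← hPdef,
          ← hpow, Nat.cast_mul, Real.mul_rpow (Nat.cast_nonneg _) (Nat.cast_nonneg _)]
        ring

/-- **The pointwise majorant** `T(k) ≤ M(k)` for all `k ≥ 1` (`0 ≤ α ≤ 1`), by multiplicativity. [folklore] -/
theorem parityUnitTermR_le_unitMajorant {α : ℝ} (hα0 : 0 ≤ α) (hα1 : α ≤ 1) (d₁ d₂ : ℕ) {k : ℕ} (hk : k ≠ 0) :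
    parityUnitTermR α d₁ d₂ k ≤ unitMajorant α d₁ d₂ k := by
  induction k using Nat.recOnPosPrimePosCoprime with
  | zero => exact absurd rfl hk
  | one => simp [parityUnitTermR_one, unitMajorant]
  | prime_pow p n hp hn => exact parityUnitTermR_prime_pow_le hα0 hα1 d₁ d₂ hp hn
  | coprime a b ha hb hab iha ihb =>
    rw [parityUnitTermR_mul_of_coprime α d₁ d₂ hab, unitMajorant_mul_of_coprime α d₁ d₂ hab]
    exact mul_le_mul (iha (by omega)) (ihb (by omega)) (parityUnitTermR_nonneg hα0 hα1 _ _ _)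
      (unitMajorant_nonneg hα1 _ _ _)

/-! ### Summation: the Euler-product bound -/

/-- `c_p ≤ 1210 (1 − α) p^{3/5}` for `p ≥ 1`, `0 ≤ α ≤ 1` (`log p ≤ 5 p^{1/5}`). [folklore] -/
theorem majorConst_le {α : ℝ} (hα0 : 0 ≤ α) (hα1 : α ≤ 1) {p : ℕ} (hp : 1 ≤ p) :
    majorConst α p ≤ 1210 * (1 - α) * (p : ℝ) ^ (3 / 5 : ℝ) := by
  unfold majorConst
  have hp1 : (1 : ℝ) ≤ p := by exact_mod_cast hp
  have hq1 : 1 ≤ (p : ℝ) ^ (1 / 5 : ℝ) := Real.one_le_rpow hp1 (by norm_num)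
  have hlog0 : 0 ≤ Real.log p := Real.log_nonneg hp1
  have hlog : Real.log p ≤ 5 * (p : ℝ) ^ (1 / 5 : ℝ) := Endgame.log_le_five_mul_rpow (by linarith)
  have h1α : 0 ≤ 1 - α := by linarith
  have hq3 : ((p : ℝ) ^ (1 / 5 : ℝ)) ^ 3 = (p : ℝ) ^ (3 / 5 : ℝ) := by
    rw [← Real.rpow_natCast, ← Real.rpow_mul (by linarith)]
    norm_num
  have hBle : 2 * (1 - α) * Real.log p ≤ 10 * (1 - α) * (p : ℝ) ^ (1 / 5 : ℝ) := by nlinarith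
  have h1B : 1 + 2 * (1 - α) * Real.log p ≤ 11 * (p : ℝ) ^ (1 / 5 : ℝ) := by nlinarith
  have h1B0 : 0 ≤ 1 + 2 * (1 - α) * Real.log p := by positivity
  calc 2 * (1 - α) * Real.log p * (1 + 2 * (1 - α) * Real.log p) ^ 2
      ≤ (10 * (1 - α) * (p : ℝ) ^ (1 / 5 : ℝ)) * (11 * (p : ℝ) ^ (1 / 5 : ℝ)) ^ 2 :=
        mul_le_mul hBle (pow_le_pow_left₀ h1B0 h1B 2) (by positivity) (by positivity)
    _ = 1210 * (1 - α) * ((p : ℝ) ^ (1 / 5 : ℝ)) ^ 3 := by ring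
    _ = 1210 * (1 - α) * (p : ℝ) ^ (3 / 5 : ℝ) := by rw [hq3]

/-- **Euler-product bound for the weighted unit terms.** For `13/15 < α ≤ 1`, `δ < 3α − 13/5`, `d₁, d₂ ≥ 1`:
`Σ_{1 ≤ k ≤ N} k^δ T(k) ≤ (d₁d₂)^α exp(2420 (1 − α)/(3α − 13/5 − δ))` (pointwise majorant, `(d_i, k) ≤ d_i`,
`sum_rpow_neg_mul_prod_primeFactors_le` with `s = 3α − 1 − δ`, `c_p ≤ 1210(1−α)p^{3/5}` and `Σ_p p^{−(s−3/5)} ≤ 1/(s − 8/5)`).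
[cite: MontgomeryVaughan2007, §1.3, Theorem 1.9] -/
theorem sum_rpow_mul_parityUnitTermR_le {α : ℝ} (hα : 13 / 15 < α) (hα1 : α ≤ 1) {δ : ℝ}
    (hδ : δ < 3 * α - 13 / 5) {d₁ d₂ : ℕ} (hd₁ : d₁ ≠ 0) (hd₂ : d₂ ≠ 0) (N : ℕ) :
    ∑ k ∈ Finset.Icc 1 N, (k : ℝ) ^ δ * parityUnitTermR α d₁ d₂ k ≤
      ((d₁ * d₂ : ℕ) : ℝ) ^ α * Real.exp (2420 * (1 - α) / (3 * α - 13 / 5 - δ)) := by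
  have hα0 : 0 ≤ α := by linarith
  have hs1 : 1 ≤ 3 * α - 1 - δ := by linarith
  have hD : 0 ≤ ((d₁ * d₂ : ℕ) : ℝ) ^ α := Real.rpow_nonneg (Nat.cast_nonneg _) _
  have hpt : ∀ k ∈ Finset.Icc 1 N, (k : ℝ) ^ δ * parityUnitTermR α d₁ d₂ k ≤
      ((d₁ * d₂ : ℕ) : ℝ) ^ α * ((k : ℝ) ^ (-(3 * α - 1 - δ)) * ∏ p ∈ k.primeFactors, majorConst α p) := by
    intro k hk
    have hk0 : k ≠ 0 := by have := (Finset.mem_Icc.mp hk).1; omega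
    have hk0' : (0 : ℝ) < k := by exact_mod_cast Nat.pos_of_ne_zero hk0
    have hM := parityUnitTermR_le_unitMajorant hα0 hα1 d₁ d₂ hk0
    have hgcdn : Nat.gcd d₁ k * Nat.gcd d₂ k ≤ d₁ * d₂ :=
      Nat.mul_le_mul (Nat.gcd_le_left k (Nat.pos_of_ne_zero hd₁)) (Nat.gcd_le_left k (Nat.pos_of_ne_zero hd₂))
    have hgcd : ((Nat.gcd d₁ k * Nat.gcd d₂ k : ℕ) : ℝ) ^ α ≤ ((d₁ * d₂ : ℕ) : ℝ) ^ α :=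
      Real.rpow_le_rpow (Nat.cast_nonneg _) (by exact_mod_cast hgcdn) hα0
    have hks : (k : ℝ) ^ δ * (k : ℝ) ^ (-(3 * α - 1)) = (k : ℝ) ^ (-(3 * α - 1 - δ)) := by
      rw [← Real.rpow_add hk0']; congr 1; ring
    have hP0 : 0 ≤ ∏ p ∈ k.primeFactors, majorConst α p := Finset.prod_nonneg fun p _ => majorConst_nonneg hα1 p
    calc (k : ℝ) ^ δ * parityUnitTermR α d₁ d₂ k ≤ (k : ℝ) ^ δ * unitMajorant α d₁ d₂ k :=
          mul_le_mul_of_nonneg_left hM (Real.rpow_nonneg hk0'.le _)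
      _ = ((Nat.gcd d₁ k * Nat.gcd d₂ k : ℕ) : ℝ) ^ α *
            ((k : ℝ) ^ (-(3 * α - 1 - δ)) * ∏ p ∈ k.primeFactors, majorConst α p) := by
          rw [unitMajorant, ← hks]; ring
      _ ≤ _ := mul_le_mul_of_nonneg_right hgcd (mul_nonneg (Real.rpow_nonneg hk0'.le _) hP0)
  refine (Finset.sum_le_sum hpt).trans ?_
  rw [← Finset.mul_sum]
  refine mul_le_mul_of_nonneg_left ?_ hD
  refine (Endgame.sum_rpow_neg_mul_prod_primeFactors_le hs1 (fun p => majorConst_nonneg hα1 p) N).trans ?_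
  apply Real.exp_le_exp.mpr
  have hs' : 1 < 3 * α - 1 - δ - 3 / 5 := by linarith
  have hsum := Endgame.sum_primesBelow_rpow_neg_le hs' N
  have h1α : 0 ≤ 1 - α := by linarith
  have hgap : 0 < 3 * α - 13 / 5 - δ := by linarith
  calc ∑ p ∈ (N + 1).primesBelow, 2 * majorConst α p * (p : ℝ) ^ (-(3 * α - 1 - δ))
      ≤ ∑ p ∈ (N + 1).primesBelow, 2420 * (1 - α) * (p : ℝ) ^ (-(3 * α - 1 - δ - 3 / 5)) := by
        refine Finset.sum_le_sum fun p hp => ?_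
        have hpp := (Nat.mem_primesBelow.mp hp).2
        have hp0 : (0 : ℝ) < p := by exact_mod_cast hpp.pos
        have hc := majorConst_le hα0 hα1 hpp.one_le
        have hr0 : 0 ≤ (p : ℝ) ^ (-(3 * α - 1 - δ)) := Real.rpow_nonneg hp0.le _
        have e : (p : ℝ) ^ (3 / 5 : ℝ) * (p : ℝ) ^ (-(3 * α - 1 - δ)) = (p : ℝ) ^ (-(3 * α - 1 - δ - 3 / 5)) := by
          rw [← Real.rpow_add hp0]; congr 1; ring
        calc 2 * majorConst α p * (p : ℝ) ^ (-(3 * α - 1 - δ))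
            ≤ 2 * (1210 * (1 - α) * (p : ℝ) ^ (3 / 5 : ℝ)) * (p : ℝ) ^ (-(3 * α - 1 - δ)) :=
              mul_le_mul_of_nonneg_right (by linarith) hr0
          _ = 2420 * (1 - α) * ((p : ℝ) ^ (3 / 5 : ℝ) * (p : ℝ) ^ (-(3 * α - 1 - δ))) := by ring
          _ = _ := by rw [e]
    _ = 2420 * (1 - α) * ∑ p ∈ (N + 1).primesBelow, (p : ℝ) ^ (-(3 * α - 1 - δ - 3 / 5)) := by
        rw [Finset.mul_sum]
    _ ≤ 2420 * (1 - α) * (1 / (3 * α - 1 - δ - 3 / 5 - 1)) := mul_le_mul_of_nonneg_left hsum (by positivity)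
    _ = 2420 * (1 - α) / (3 * α - 13 / 5 - δ) := by
        rw [show 3 * α - 1 - δ - 3 / 5 - 1 = 3 * α - 13 / 5 - δ by ring]
        field_simp

/-- From bounds over `Icc 1 N` to bounds over `range n` (for `f 0 = 0`). [folklore] -/
theorem sum_range_le_of_sum_Icc_le {f : ℕ → ℝ} (hf0 : f 0 = 0) {C : ℝ} (h : ∀ N, ∑ k ∈ Finset.Icc 1 N, f k ≤ C)
    (n : ℕ) : ∑ k ∈ Finset.range n, f k ≤ C := by
  rcases n with _ | m
  · simpa using h 0
  · have e : Finset.range (m + 1) = insert 0 (Finset.Icc 1 m) := by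
      ext k
      simp only [Finset.mem_range, Finset.mem_insert, Finset.mem_Icc]
      omega
    rw [e, Finset.sum_insert (by simp), hf0, zero_add]
    exact h m

/-- **Weighted absolute convergence of the unit terms**: for `13/15 < α ≤ 1`, `δ < 3α − 13/5`, `σ = ±1`,
`d₁, d₂ ≥ 1`: `k ↦ k^δ ‖parityUnitTerm k‖` is summable with sum `≤ (d₁d₂)^α exp(2420(1−α)/(3α−13/5−δ))`.
[cite: MontgomeryVaughanActa1975, §6] -/
theorem summable_rpow_mul_norm_parityUnitTerm {α : ℝ} (hα : 13 / 15 < α) (hα1 : α ≤ 1) {δ : ℝ}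
    (hδ : δ < 3 * α - 13 / 5) {σ : ℤ} (hσ : σ = 1 ∨ σ = -1) {d₁ d₂ : ℕ} (hd₁ : d₁ ≠ 0) (hd₂ : d₂ ≠ 0) :
    Summable (fun k : ℕ => (k : ℝ) ^ δ * ‖parityUnitTerm α σ d₁ d₂ k‖) ∧
      ∑' k : ℕ, (k : ℝ) ^ δ * ‖parityUnitTerm α σ d₁ d₂ k‖ ≤
        ((d₁ * d₂ : ℕ) : ℝ) ^ α * Real.exp (2420 * (1 - α) / (3 * α - 13 / 5 - δ)) := by
  have hα0 : 0 ≤ α := by linarith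
  have hg : ∀ k : ℕ, (k : ℝ) ^ δ * ‖parityUnitTerm α σ d₁ d₂ k‖ = (k : ℝ) ^ δ * parityUnitTermR α d₁ d₂ k := fun k => by
    rw [norm_parityUnitTerm hα0 hα1 hσ]
  have h0 : ∀ k : ℕ, 0 ≤ (k : ℝ) ^ δ * ‖parityUnitTerm α σ d₁ d₂ k‖ := fun k =>
    mul_nonneg (Real.rpow_nonneg (Nat.cast_nonneg k) _) (norm_nonneg _)
  have hle : ∀ n, ∑ k ∈ Finset.range n, (k : ℝ) ^ δ * ‖parityUnitTerm α σ d₁ d₂ k‖ ≤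
      ((d₁ * d₂ : ℕ) : ℝ) ^ α * Real.exp (2420 * (1 - α) / (3 * α - 13 / 5 - δ)) := by
    refine sum_range_le_of_sum_Icc_le (by simp [parityUnitTerm]) fun N => ?_
    simp_rw [hg]
    exact sum_rpow_mul_parityUnitTermR_le hα hα1 hδ hd₁ hd₂ N
  exact ⟨summable_of_sum_range_le h0 hle, Real.tsum_le_of_sum_range_le h0 hle⟩

/-! ### Comparison of the singular-series terms with the unit terms -/

/-- `‖paritySingTerm (2k+1)‖ ≤ ‖parityUnitTerm (2k+1)‖` (`paritySingTerm 1 = (1 − 2^{−α})² ≤ 1`). [folklore] -/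
theorem norm_paritySingTerm_odd_le {α : ℝ} (hα0 : 0 ≤ α) (σ : ℤ) (d₁ d₂ k : ℕ) :
    ‖paritySingTerm α σ d₁ d₂ (2 * k + 1)‖ ≤ ‖parityUnitTerm α σ d₁ d₂ (2 * k + 1)‖ := by
  have h := paritySingTerm_mul_of_coprime α σ d₁ d₂ (Nat.coprime_one_left (2 * k + 1)) (odd_two_mul_add_one k)
  rw [one_mul] at h
  rw [h, norm_mul, paritySingTerm_one, Complex.norm_real, Real.norm_of_nonneg (sq_nonneg _)]
  have h2 : (2 : ℝ) ^ (-α) ≤ 1 := Real.rpow_le_one_of_one_le_of_nonpos (by norm_num) (by linarith)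
  have h2' : 0 ≤ (2 : ℝ) ^ (-α) := Real.rpow_nonneg (by norm_num) _
  calc (1 - (2 : ℝ) ^ (-α)) ^ 2 * ‖parityUnitTerm α σ d₁ d₂ (2 * k + 1)‖
      ≤ 1 * ‖parityUnitTerm α σ d₁ d₂ (2 * k + 1)‖ := mul_le_mul_of_nonneg_right (by nlinarith) (norm_nonneg _)
    _ = _ := one_mul _

/-- `‖paritySingTerm (2k)‖ ≤ ‖parityUnitTerm k‖` for `d₁` even, `σd₂` odd
(`k` even: the term vanishes; `k` odd: `|paritySingTerm 2| = (1 − 2^{−α})² (2^{1−α} − 1) ≤ 1`). [folklore] -/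
theorem norm_paritySingTerm_two_mul_le {α : ℝ} (hα0 : 0 ≤ α) (hα1 : α ≤ 1) {σ : ℤ} {d₂ : ℕ} (hσd : Odd (σ * d₂))
    {d₁ : ℕ} (hd₁ : Even d₁) (k : ℕ) : ‖paritySingTerm α σ d₁ d₂ (2 * k)‖ ≤ ‖parityUnitTerm α σ d₁ d₂ k‖ := by
  rcases Nat.even_or_odd k with hk | hk
  · rw [paritySingTerm_eq_zero_of_four_dvd α hσd d₁ (by obtain ⟨m, rfl⟩ := hk; exact ⟨m, by ring⟩), norm_zero]
    exact norm_nonneg _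
  · rw [paritySingTerm_mul_of_coprime α σ d₁ d₂ (Nat.prime_two.coprime_iff_not_dvd.mpr hk.not_two_dvd_nat) hk,
      norm_mul, paritySingTerm_two α hσd hd₁, Complex.norm_real]
    have h2 : (2 : ℝ) ^ (-α) ≤ 1 := Real.rpow_le_one_of_one_le_of_nonpos (by norm_num) (by linarith)
    have h2' : (1 : ℝ) / 2 ≤ (2 : ℝ) ^ (-α) := by
      rw [show (1 : ℝ) / 2 = (2 : ℝ) ^ (-1 : ℝ) by rw [Real.rpow_neg_one]; norm_num]
      exact Real.rpow_le_rpow_of_exponent_le (by norm_num) (by linarith)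
    have hc : ‖-((1 - (2 : ℝ) ^ (-α)) ^ 2 * (2 * (2 : ℝ) ^ (-α) - 1))‖ ≤ 1 := by
      rw [norm_neg, Real.norm_eq_abs, abs_mul, abs_of_nonneg (sq_nonneg _)]
      have hx : |2 * (2 : ℝ) ^ (-α) - 1| ≤ 1 := abs_le.mpr ⟨by linarith, by linarith⟩
      calc (1 - (2 : ℝ) ^ (-α)) ^ 2 * |2 * (2 : ℝ) ^ (-α) - 1| ≤ 1 * 1 :=
            mul_le_mul (by nlinarith) hx (abs_nonneg _) zero_le_one
        _ = 1 := one_mul 1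
    calc _ ≤ 1 * ‖parityUnitTerm α σ d₁ d₂ k‖ := mul_le_mul_of_nonneg_right hc (norm_nonneg _)
      _ = _ := one_mul _

end SmoothArcs

end Literature.NumberTheory.Sieve

end
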